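import Summits.Ventures.Crystal3D.Theorems.StickyWulffConstantCoaxialWallLawReducedWordRigidity
import HarnessLib

/-!
# When is a word frame PRESENTABLE in a plate system's word net? — `PlateSystem.adm_fw_iff` (the decidable form)
# (lane T, crux `TextureLiminfV5`, stmt-Ventures-23912, registered stub `stub_terraceCensus`; cf-p1 RULINGS (cccv) / (cccviii)(4))

HONEST FRAMING. Venture `Summits/Ventures/Crystal3D` (cell `crystal3d-full`), route `route-Ventures-StickyWulffConstant`, helper `--supports` the law-v5
crux `TextureLiminfV5` (stmt-Ventures-23912), lane T.  Pure word algebra over lane F's root-free REDUCED-WORD RIGIDITY (…ReducedWordRigidity,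
`reduced_forall₂_of_foldl_image_eq`); census-free, no kissing facts, nothing about energies; F-C1 not moved.

THE POINT.  Under cf-p1 (cccv) the (β) assembly pools every family — plate lines AND the born lines of the filling's lamellae — under ONE bi-frame row of
the two PLATE systems `basalSystem G₁ = ⟨G₁, basalHexagon⟩`, `basalSystem G₂`; a born family launched in a lamella frame `A = S.Fw κ₀` (the word's first
letters) along `c` enters the count only if its class is ADMISSIBLE, `S.Adm (S.Fw κ₀) c` (…LevelReachBornRoot `isEndPairA_of_rootMove`).  Unfolding
`PlateSystem.Adm` this asks for a root `r ∈ S.RT` and a WELL-FORMED chain with that frame and direction; the SIGN of each chain letter is the chain's choice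
(`M_μ = M_{−μ}`), so the geometric content is:

* **`PlateSystem.exists_signed_wfChain_of_crossed`** — if `r` is a slot and the reduced word `κ₀` (unit model `{111}` menu letters, consecutive letters at
  `±1/3`) has NO letter plane containing `r` (`⟪r, μ⟫ ≠ 0` for every letter), then some re-signing `κ ≃± κ₀` is a well-formed chain of `r`;
* **`PlateSystem.adm_fw_of_crossed`** (SUFFICIENT — what the assembly discharges per born family): `r ∈ S.RT`, `κ₀` reduced, every letter crossed by `r`
  ⇒ `S.Adm (S.Fw κ₀) (S.Fw κ₀ ((−1)^{|κ₀|} • r))`;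
* **`PlateSystem.exists_root_of_adm_fw`** (NECESSARY — exactness of the presentability filter): `S.Adm (S.Fw κ₀) c` for a reduced `κ₀` ⇒
  `∃ r ∈ S.RT`, every letter crossed by `r`, and `c = S.Fw κ₀ ((−1)^{|κ₀|} • r)` (reduced-word rigidity pins the chain to `κ₀` up to signs);
* **`PlateSystem.adm_fw_iff`** — the two together (`S.RT ⊆ fccSlots`): the decidable criterion «(1) the back-traced root is in `S.RT` ∧ (2′) no letter plane
  contains it» of the presentability TRIPWIRE (19480-p2 g16, INBOX 23:05Z/23:17Z; cf-p1 (cccviii)).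
COUNT (informal, for supply.py): a non-basal `{111}` plane contains exactly two of the six basal slots, so with `S.RT = basalHexagon` one letter leaves 4
roots, two letters with distinct basal traces leave 2, three pairwise distinct traces leave 0; periodic words keep 2.
WHAT THIS IS NOT: not a supply bound, not the pooling, no certificate; F-C1 not moved.
-/

noncomputable section

namespace Summit.Ventures.Crystal3D.Theorems

namespace PlateSystem

open Summit.Ventures.Crystal3D Finset
open scoped InnerProductSpace

/-- Membership transport along a `Forall₂ (· = · ∨ · = −·)` relation: every letter of the right word is `±` a letter of the left word. -/
theorem exists_mem_of_forall₂_sign :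
    ∀ {κ κ' : List (EuclideanSpace ℝ (Fin 3))}, List.Forall₂ (fun a b => a = b ∨ a = -b) κ κ' →
      ∀ μ ∈ κ', ∃ a ∈ κ, a = μ ∨ a = -μ := by
  intro κ κ' h
  induction h with
  | nil => intro μ hμ; simp at hμ
  | @cons a b l l' hab _ ih =>
    intro μ hμ
    rcases List.mem_cons.1 hμ with rfl | hμ
    · exact ⟨a, List.mem_cons_self, hab⟩
    · obtain ⟨a', ha', h'⟩ := ih μ hμ
      exact ⟨a', List.mem_cons_of_mem _ ha', h'⟩

/-- **Re-signing a reduced word into a well-formed chain.**  `r` a slot, `κ₀` a reduced word of unit model `{111}` menu letters (consecutive letters at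
`±1/3`), no letter plane containing `r` ⇒ some letterwise re-signing of `κ₀` is a well-formed chain of the root `r`. -/
theorem exists_signed_wfChain_of_crossed {r : EuclideanSpace ℝ (Fin 3)} (hr : r ∈ fccSlots) :
    ∀ κ₀ : List (EuclideanSpace ℝ (Fin 3)),
      (∀ μ ∈ κ₀, ‖μ‖ = 1 ∧ ∀ w ∈ fccSlots, ⟪w, μ⟫_ℝ = 0 ∨ ⟪w, μ⟫_ℝ = Real.sqrt (2 / 3) ∨ ⟪w, μ⟫_ℝ = -Real.sqrt (2 / 3)) →
      List.IsChain (fun μ μ' => ⟪μ, μ'⟫_ℝ = 1 / 3 ∨ ⟪μ, μ'⟫_ℝ = -1 / 3) κ₀ →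
      (∀ μ ∈ κ₀, ⟪r, μ⟫_ℝ ≠ 0) →
      ∃ κ, List.Forall₂ (fun a b => a = b ∨ a = -b) κ κ₀ ∧ WFChain r κ := by
  intro κ₀
  induction κ₀ with
  | nil => intro _ _ _; exact ⟨[], List.Forall₂.nil, wfChain_nil r⟩
  | cons μ κ₀ ih =>
    intro hlet hchain hcross
    obtain ⟨κ, hκκ₀, hκ⟩ := ih (fun ν hν => hlet ν (List.mem_cons_of_mem _ hν)) (List.IsChain.tail hchain |>.imp fun _ _ h => h)
      (fun ν hν => hcross ν (List.mem_cons_of_mem _ hν))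
    obtain ⟨hμ1, hμmenu⟩ := hlet μ List.mem_cons_self
    have hμ0 : ⟪r, μ⟫_ℝ ≠ 0 := hcross μ List.mem_cons_self
    -- the running root `(−1)^{|κ|} • r` is a slot; it sees `μ` at `±√(2/3)`
    set s : EuclideanSpace ℝ (Fin 3) := ((-1 : ℝ) ^ κ.length) • r with hs
    have hsslot : s ∈ fccSlots := by
      rcases neg_one_pow_eq_or ℝ κ.length with h1 | h1
      · rw [hs, h1, one_smul]; exact hr
      · rw [hs, h1, neg_one_smul]; exact neg_mem_fccSlots hr
    have hsμ : ⟪s, μ⟫_ℝ = Real.sqrt (2 / 3) ∨ ⟪s, μ⟫_ℝ = -Real.sqrt (2 / 3) := by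
      rcases hμmenu s hsslot with h0 | h0 | h0
      · exfalso
        apply hμ0
        rcases neg_one_pow_eq_or ℝ κ.length with h1 | h1
        · rw [hs, h1, one_smul] at h0; exact h0
        · rw [hs, h1, neg_one_smul, inner_neg_left, neg_eq_zero] at h0; exact h0
      · exact Or.inl h0
      · exact Or.inr h0
    -- the head of `κ` is `±` the head of `κ₀`, at `±1/3` from `μ`: never `∓` the new signed letter
    have hhead : ∀ μ' κ', κ = μ' :: κ' → ⟪μ, μ'⟫_ℝ = 1 / 3 ∨ ⟪μ, μ'⟫_ℝ = -1 / 3 := by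
      intro μ' κ' hκeq
      rw [hκeq] at hκκ₀
      cases hκκ₀ with
      | @cons a b l l' hab hrest =>
        have hμb : ⟪μ, b⟫_ℝ = 1 / 3 ∨ ⟪μ, b⟫_ℝ = -1 / 3 := by
          cases hchain with
          | cons_cons hR _ => exact hR
        rcases hab with rfl | rfl
        · exact hμb
        · rw [inner_neg_right]
          rcases hμb with h | h
          · right; rw [h]; norm_num
          · left; rw [h]; norm_num
    have hnc : ∀ (μs : EuclideanSpace ℝ (Fin 3)), (μs = μ ∨ μs = -μ) → ∀ μ' κ', κ = μ' :: κ' → μ' ≠ -μs := by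
      intro μs hμs μ' κ' hκeq hbad
      have h13 := hhead μ' κ' hκeq
      have hself : ⟪μ, μ⟫_ℝ = 1 := by rw [real_inner_self_eq_norm_sq, hμ1, one_pow]
      rcases hμs with rfl | rfl
      · rw [hbad, inner_neg_right, hself] at h13; rcases h13 with h | h <;> norm_num at h
      · rw [hbad, neg_neg, hself] at h13; rcases h13 with h | h <;> norm_num at h
    rcases hsμ with hpos | hneg
    · refine ⟨μ :: κ, List.Forall₂.cons (Or.inl rfl) hκκ₀, ?_⟩
      rw [wfChain_cons]
      exact ⟨hκ, hμ1, hμmenu, hpos, hnc μ (Or.inl rfl)⟩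
    · refine ⟨(-μ) :: κ, List.Forall₂.cons (Or.inr rfl) hκκ₀, ?_⟩
      rw [wfChain_cons]
      refine ⟨hκ, by rw [norm_neg, hμ1], fun w hw => ?_, by rw [inner_neg_right, hneg, neg_neg], hnc (-μ) (Or.inr rfl)⟩
      rcases hμmenu w hw with h0 | h0 | h0
      · left; rw [inner_neg_right, h0, neg_zero]
      · right; right; rw [inner_neg_right, h0]
      · right; left; rw [inner_neg_right, h0, neg_neg]

/-- **SUFFICIENT: a word frame is presentable along every root that crosses all its letter planes.**  `r ∈ S.RT ⊆ fccSlots`, `κ₀` reduced, no letter plane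
containing `r` ⇒ the class `(S.Fw κ₀, S.Fw κ₀ ((−1)^{|κ₀|} • r))` is admissible. -/
theorem adm_fw_of_crossed (S : PlateSystem) (hS : S.RT ⊆ fccSlots) {r : EuclideanSpace ℝ (Fin 3)} (hr : r ∈ S.RT)
    {κ₀ : List (EuclideanSpace ℝ (Fin 3))}
    (hlet : ∀ μ ∈ κ₀, ‖μ‖ = 1 ∧ ∀ w ∈ fccSlots, ⟪w, μ⟫_ℝ = 0 ∨ ⟪w, μ⟫_ℝ = Real.sqrt (2 / 3) ∨ ⟪w, μ⟫_ℝ = -Real.sqrt (2 / 3))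
    (hchain : List.IsChain (fun μ μ' => ⟪μ, μ'⟫_ℝ = 1 / 3 ∨ ⟪μ, μ'⟫_ℝ = -1 / 3) κ₀)
    (hcross : ∀ μ ∈ κ₀, ⟪r, μ⟫_ℝ ≠ 0) :
    S.Adm (S.Fw κ₀) (S.Fw κ₀ (((-1 : ℝ) ^ κ₀.length) • r)) := by
  obtain ⟨κ, hκκ₀, hκ⟩ := exists_signed_wfChain_of_crossed (hS hr) κ₀ hlet hchain hcross
  have hunit : ∀ μ ∈ κ, ‖μ‖ = 1 := fun μ hμ => ((wfChain_letters hκ).1 μ hμ).1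
  have hunit₀ : ∀ μ ∈ κ₀, ‖μ‖ = 1 := fun μ hμ => (hlet μ hμ).1
  have hF : S.Fw κ = S.Fw κ₀ := fw_eq_of_forall₂ S hκκ₀ hunit hunit₀
  have hlen : κ.length = κ₀.length := hκκ₀.length_eq
  exact ⟨r, hr, κ, hκ, hF.symm, by rw [hF, hlen]⟩

/-- **NECESSARY: an admissible class on a word frame is a crossing root's class.**  `κ₀` reduced and `S.Adm (S.Fw κ₀) c` ⇒ some root `r ∈ S.RT` crosses every
letter plane of `κ₀` and `c = S.Fw κ₀ ((−1)^{|κ₀|} • r)` (reduced-word rigidity pins the admissible chain to `κ₀` up to letter signs). -/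
theorem exists_root_of_adm_fw (S : PlateSystem) {κ₀ : List (EuclideanSpace ℝ (Fin 3))}
    (hlet : ∀ μ ∈ κ₀, ‖μ‖ = 1 ∧ ∀ w ∈ fccSlots, ⟪w, μ⟫_ℝ = 0 ∨ ⟪w, μ⟫_ℝ = Real.sqrt (2 / 3) ∨ ⟪w, μ⟫_ℝ = -Real.sqrt (2 / 3))
    (hchain : List.IsChain (fun μ μ' => ⟪μ, μ'⟫_ℝ = 1 / 3 ∨ ⟪μ, μ'⟫_ℝ = -1 / 3) κ₀)
    {c : EuclideanSpace ℝ (Fin 3)} (h : S.Adm (S.Fw κ₀) c) :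
    ∃ r ∈ S.RT, (∀ μ ∈ κ₀, ⟪r, μ⟫_ℝ ≠ 0) ∧ c = S.Fw κ₀ (((-1 : ℝ) ^ κ₀.length) • r) := by
  obtain ⟨r, hr, κ, hκ, hG, hd⟩ := h
  obtain ⟨hletκ, hchainκ⟩ := wfChain_letters hκ
  have hunit : ∀ μ ∈ κ, ‖μ‖ = 1 := fun μ hμ => (hletκ μ hμ).1
  have hunit₀ : ∀ μ ∈ κ₀, ‖μ‖ = 1 := fun μ hμ => (hlet μ hμ).1
  have himg : (S.Fw κ : EuclideanSpace ℝ (Fin 3) → EuclideanSpace ℝ (Fin 3)) '' ↑fccSlots =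
      (S.Fw κ₀ : EuclideanSpace ℝ (Fin 3) → EuclideanSpace ℝ (Fin 3)) '' ↑fccSlots := by rw [hG]
  have hsign : List.Forall₂ (fun a b => a = b ∨ a = -b) κ κ₀ :=
    reduced_forall₂_of_foldl_image_eq κ κ₀ hletκ hlet hchainκ hchain (foldl_image_eq_of_image_fw_eq S hunit hunit₀ himg)
  have hlen : κ.length = κ₀.length := hsign.length_eq
  have hr0 : 0 < Real.sqrt (2 / 3) := Real.sqrt_pos.2 (by norm_num)
  refine ⟨r, hr, fun μ hμ => ?_, by rw [hd, ← hG, hlen]⟩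
  obtain ⟨a, ha, hab⟩ := exists_mem_of_forall₂_sign hsign μ hμ
  have hob := wfChain_oblique hκ a ha
  rcases hab with rfl | rfl
  · rcases hob with h1 | h1
    · rw [h1]; exact hr0.ne'
    · rw [h1]; exact neg_ne_zero.2 hr0.ne'
  · rw [inner_neg_right] at hob
    rcases hob with h1 | h1
    · intro h0; rw [h0, neg_zero] at h1; exact hr0.ne h1
    · intro h0; rw [h0, neg_zero] at h1; linarith

/-- **THE DECIDABLE PRESENTABILITY CRITERION** (`adm_wordFrame_iff` of the tripwire): for a system with slot roots and a reduced word `κ₀`, the class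
`(S.Fw κ₀, c)` is admissible iff some root `r ∈ S.RT` crosses every letter plane of `κ₀` (`⟪r, μ⟫ ≠ 0`) and `c = S.Fw κ₀ ((−1)^{|κ₀|} • r)`. -/
theorem adm_fw_iff (S : PlateSystem) (hS : S.RT ⊆ fccSlots) {κ₀ : List (EuclideanSpace ℝ (Fin 3))}
    (hlet : ∀ μ ∈ κ₀, ‖μ‖ = 1 ∧ ∀ w ∈ fccSlots, ⟪w, μ⟫_ℝ = 0 ∨ ⟪w, μ⟫_ℝ = Real.sqrt (2 / 3) ∨ ⟪w, μ⟫_ℝ = -Real.sqrt (2 / 3))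
    (hchain : List.IsChain (fun μ μ' => ⟪μ, μ'⟫_ℝ = 1 / 3 ∨ ⟪μ, μ'⟫_ℝ = -1 / 3) κ₀) (c : EuclideanSpace ℝ (Fin 3)) :
    S.Adm (S.Fw κ₀) c ↔ ∃ r ∈ S.RT, (∀ μ ∈ κ₀, ⟪r, μ⟫_ℝ ≠ 0) ∧ c = S.Fw κ₀ (((-1 : ℝ) ^ κ₀.length) • r) := by
  constructor
  · exact exists_root_of_adm_fw S hlet hchain
  · rintro ⟨r, hr, hcross, rfl⟩
    exact adm_fw_of_crossed S hS hr hlet hchain hcross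

/-! ### One-letter words (the plate-adjacent lamellae — the only presentable born supply of record, PRESENTABLE-SUPPLY-g24) -/

/-- **One letter**: for the lamella across the FIRST twin plane `μ` of a plate with slot roots, the class `(S.Fw [μ], c)` is admissible iff some root
`r ∈ S.RT` is off the plane `μ` (`⟪r, μ⟫ ≠ 0`) and `c = S.Fw [μ] (−r)` — the explicit one-letter `Adm` witness the four-family pooled census consumes. -/
theorem adm_fw_singleton_iff (S : PlateSystem) (hS : S.RT ⊆ fccSlots) {μ : EuclideanSpace ℝ (Fin 3)} (hμ1 : ‖μ‖ = 1)
    (hμmenu : ∀ w ∈ fccSlots, ⟪w, μ⟫_ℝ = 0 ∨ ⟪w, μ⟫_ℝ = Real.sqrt (2 / 3) ∨ ⟪w, μ⟫_ℝ = -Real.sqrt (2 / 3))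
    (c : EuclideanSpace ℝ (Fin 3)) :
    S.Adm (S.Fw [μ]) c ↔ ∃ r ∈ S.RT, ⟪r, μ⟫_ℝ ≠ 0 ∧ c = S.Fw [μ] (-r) := by
  have key := adm_fw_iff S hS (κ₀ := [μ]) (fun ν hν => by rw [List.mem_singleton.1 hν]; exact ⟨hμ1, hμmenu⟩)
    (List.isChain_singleton μ) c
  simp only [List.mem_singleton, forall_eq, List.length_singleton, pow_one, neg_one_smul] at key
  exact key

/-- **One letter, sufficient form**: `r ∈ S.RT` off the plane `μ` ⇒ `S.Adm (S.Fw [μ]) (S.Fw [μ] (−r))`. -/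
theorem adm_fw_singleton_of_crossed (S : PlateSystem) (hS : S.RT ⊆ fccSlots) {μ : EuclideanSpace ℝ (Fin 3)} (hμ1 : ‖μ‖ = 1)
    (hμmenu : ∀ w ∈ fccSlots, ⟪w, μ⟫_ℝ = 0 ∨ ⟪w, μ⟫_ℝ = Real.sqrt (2 / 3) ∨ ⟪w, μ⟫_ℝ = -Real.sqrt (2 / 3))
    {r : EuclideanSpace ℝ (Fin 3)} (hr : r ∈ S.RT) (hcross : ⟪r, μ⟫_ℝ ≠ 0) : S.Adm (S.Fw [μ]) (S.Fw [μ] (-r)) :=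
  (adm_fw_singleton_iff S hS hμ1 hμmenu _).2 ⟨r, hr, hcross, rfl⟩

end PlateSystem

end Summit.Ventures.Crystal3D.Theorems

end
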